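import Literature.AnabelianGeometry.SemiGraphs.TemperedPiPointSeqFibreIso
import Literature.AnabelianGeometry.SemiGraphs.TemperedPiChartExists
import Literature.AnabelianGeometry.SemiGraphs.TemperedPiDecompositionEdgesStab
import Literature.AnabelianGeometry.SemiGraphs.TemperedPiLevelDataOfTower
import Literature.AnabelianGeometry.SemiGraphs.TemperedReconstructionReductionsProofs
import Literature.AnabelianGeometry.SemiGraphs.UniversalCoveringOverProofs
import HarnessLib

/-!
# The level data of [SemiAnbd] Thm 3.7 (iii) for the tempered fundamental group of Prop 3.6 ([SemiAnbd] §3 pp. 38–41)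

Mochizuki, *Semi-graphs of anabelioids*, Publ. RIMS **42** (2006) [MochizukiSemiAnbd2006], §3:
Prop. 3.6 (ii) p. 38 ("natural equivalence of categories `B^temp(π₁^temp(𝒢)) ⥲ B^temp(𝒢)`"),
Thm. 3.7 (i) p. 40 ("natural continuous injective outer homomorphism `π̂₁(𝒢_v) ↪ π₁^temp(𝒢)` … the
verticial subgroups") and the proof of Thm. 3.7 (iii) p. 41 with the author's *Comments* (2020) item
(6) ("a compatible system of vertices of `𝒢_{∞,j}` … fixed by `H`. Thus … `H` is contained in some
verticial subgroup"; "such images of '`π̂₁(𝒢_e)`'s' … edge-like subgroups").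

ASSEMBLY of row (β)-1 (seat abc-iut-L3-t8): for `𝒢` under the hypotheses of Prop. 3.6 and the chart
`𝒢.temperedPiChart h36` CONSTRUCTED by seat abc-iut-L3-t9 (`π₁^temp(𝒢) = lim_n Aut(𝒢_{∞,S n})`, fibre
functor equivalence `TemperedPiChartExists.lean`), the three identifications (I1) `fix`, (I2) `stab`,
(I3) `edge` of `TemperedLevelData.lean` hold for the trees of the Galois tower — from the TREE halves of
seat abc-iut-L3-t6 (`TemperedPiDecomposition(Stab/Edges/EdgesStab).lean`: decomposition homomorphisms of
compatible point / edge-point sequences, their images contain the stabilisers of the vertex / edge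
systems) and the CHART halves of `TemperedPiPointSeqFibre(Iso).lean`:

* `PointSeq.restrictVIso`, `isVerticialHom_decompHomCont` — the decomposition homomorphism of a
  compatible point sequence over `v` IS VERTICIAL: restriction to `v` ≅ (fibre functor) ⋙
  `B^temp(P.decompHom)`, naturally (the fibre isomorphisms);
* `exists_pointSeq_of_isVerticialHom` — every verticial homomorphism is such a decomposition
  homomorphism (its natural isomorphism evaluated on the tower `𝒢_{∞,S n}` gives the points);
* `isEdgeHom_decompHomEcont` — edge decomposition homomorphisms are edge homomorphisms;
* `fix_temperedPiChart`, `stab_temperedPiChart`, `edge_temperedPiChart` — (I1), (I2), (I3) in the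
  binder shapes of `GaloisLevelData.verticialLevelDataOfTower` (with `ρ = id`), and the level data
  `verticialLevelData_temperedPiChart : VerticialLevelData 𝒢 (𝒢.temperedPiChart h36)` — the rung-1
  PRODUCER CONTRACT of `TemperedLevelData.lean` for the constructed chart.

Proof-only over the cited files; nothing here bears on [IUTchIII] Cor. 3.12.
-/

namespace Literature.AnabelianGeometry.SemiGraphs

namespace ProfiniteSemiGraph

open CategoryTheory Topology

universe u

variable (𝒢 : ProfiniteSemiGraph.{u}) (h36 : 𝒢.Prop36Hypotheses)

/-! ### The tower `𝒢_{∞,S n}` of the constructed chart: temperedness and splitting -/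

/-- The universal coverings `𝒢_{∞,S n}` of the tower are tempered. [cite: MochizukiSemiAnbd2006, Prop 3.6 p.38] -/
theorem galoisLevelData_cover_isTempered (n : ℕ) :
    ((𝒢.galoisLevelData h36).cover h36.isCountable n).IsTempered :=
  CovObj.univCoverOver_isTempered _ _ h36.isCountable (𝒢.galoisLevelData_isFinite h36 n)
    (𝒢.galoisLevelData_hasNonemptyFibres h36 n) (𝒢.galoisLevelData_splits_self h36 n)

/-- `𝒢_{∞,S n}` as an object of `B^temp(𝒢)`. [cite: MochizukiSemiAnbd2006, Prop 3.6 p.38] -/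
noncomputable def coverT (n : ℕ) : BTempCat 𝒢 :=
  ⟨(𝒢.galoisLevelData h36).cover h36.isCountable n, 𝒢.galoisLevelData_cover_isTempered h36 n⟩

/-- `S m`, `m ≥ n`... in particular `S n` splits the component of the base point of `𝒢_{∞,S n}`.
[cite: MochizukiSemiAnbd2006, Prop 3.6 p.38] -/
theorem galoisLevelData_splits_component_bp (n : ℕ) :
    ((𝒢.galoisLevelData h36).S n).Splits (((𝒢.galoisLevelData h36).cover h36.isCountable n).component
      (Sum.inl ⟨(𝒢.galoisLevelData h36).v₀, (𝒢.galoisLevelData h36).bp n⟩)) :=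
  CovObj.Splits.of_hom_right (((𝒢.galoisLevelData h36).cover h36.isCountable n).componentι _)
    (fun _ _ _ hab => Subtype.ext hab) (fun _ _ _ hab => Subtype.ext hab)
    (((𝒢.galoisLevelData h36).S n).splits_univCoverOver _ h36.isCountable
      (𝒢.galoisLevelData_splits_self h36 n))

variable {𝒢 h36}

namespace GaloisLevelData

namespace PointSeq

variable {v : 𝒢.graph.Vertex} (P : (𝒢.galoisLevelData h36).PointSeq h36.isCountable v)

/-- **The natural isomorphism making `P.decompHom` verticial**: on `B^temp(𝒢)`, restriction to `v` is
isomorphic to the fibre functor of Prop. 3.6 (ii) followed by `B^temp(P.decompHom)`, with components the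
fibre isomorphisms `T_v ≅ (T_{v₀}, π₁^temp-action pulled back along P.decompHom)`.
[cite: MochizukiSemiAnbd2006, Thm 3.7(i) p.40] -/
noncomputable def restrictVIso :
    ObjectProperty.ι _ ⋙ restrictV 𝒢 v ≅ 𝒢.temperedFibreFunctor h36 ⋙ BTemp.res P.decompHomCont :=
  NatIso.ofComponents
    (fun T => P.fibreIso h36.isConnected T.obj (𝒢.levelOf h36 T) (𝒢.levelOf_spec h36 T))
    (fun {T T'} f => P.restrictV_map_comp_fibreIso_hom h36.isConnected T.obj (𝒢.levelOf h36 T)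
      (𝒢.levelOf_spec h36 T) f.hom (𝒢.levelOf h36 T') (𝒢.levelOf_spec h36 T'))

/-- **The decomposition homomorphism `Π_v → π₁^temp(𝒢)` of a compatible point sequence over `v` is a
VERTICIAL homomorphism at `v`** for the chart of Prop. 3.6 (i)(ii) ("natural continuous … outer
homomorphism `π̂₁(𝒢_v) → π₁^temp(𝒢)`"). [cite: MochizukiSemiAnbd2006, Thm 3.7(i) p.40] -/
theorem isVerticialHom_decompHomCont : IsVerticialHom (𝒢.temperedPiChart h36) v P.decompHomCont :=
  (isVerticialHom_iff_nonempty_functorIso _ v _).2 ⟨P.restrictVIso⟩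

/-- The image of a decomposition homomorphism is a verticial subgroup at `v`.
[cite: MochizukiSemiAnbd2006, Thm 3.7(i) p.40] -/
theorem range_decompHom_mem_verticialSubgroups :
    (P.decompHom).range ∈ verticialSubgroups (𝒢.temperedPiChart h36) v :=
  ⟨P.decompHomCont, P.isVerticialHom_decompHomCont, rfl⟩

end PointSeq

namespace EdgeSeq

variable {e : 𝒢.graph.Edge} (Q : (𝒢.galoisLevelData h36).EdgeSeq h36.isCountable e)

/-- **The edge decomposition homomorphism `Π_e → π₁^temp(𝒢)` of a compatible edge-point sequence over
`e` is an EDGE homomorphism at `e`**: glue along a branch `b : e → v` (one exists: `𝔾` is connected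
with a vertex), `decompHomE = decompHom ∘ b_*` and `decompHom` is verticial.
[cite: MochizukiSemiAnbd2006, Thm 3.7(iii) p.41] -/
theorem isEdgeHom_decompHomEcont :
    IsEdgeHom (𝒢.temperedPiChart h36) e (Q.decompHomEcont h36.isConnected) := by
  obtain ⟨b, hbe, hb⟩ := SemiGraph.exists_abuts_of_isConnected h36.isConnected (𝒢.baseVertex h36) e
  obtain ⟨v, hv⟩ := Option.isSome_iff_exists.mp hb
  subst hbe
  rw [Q.decompHomEcont_eq_comp h36.isConnected b v hv]
  exact isEdgeHom_comp_brHom _ hv (Q.gluePointSeq b v hv rfl).isVerticialHom_decompHomCont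

/-- The image of an edge decomposition homomorphism is an edge-like subgroup at `e`.
[cite: MochizukiSemiAnbd2006, Thm 3.7(iii) p.41] -/
theorem range_decompHomE_mem_edgeLikeSubgroups :
    (Q.decompHomE h36.isConnected).range ∈ edgeLikeSubgroups (𝒢.temperedPiChart h36) e :=
  ⟨Q.decompHomEcont h36.isConnected, Q.isEdgeHom_decompHomEcont, rfl⟩

end EdgeSeq

end GaloisLevelData

/-! ### Verticial homomorphisms are decomposition homomorphisms -/

section Generic

variable {P : Type u} [Group P] [TopologicalSpace P] {v : 𝒢.graph.Vertex} {ψ : 𝒢.Gv v →ₜ* P}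
  (F : BTempCat 𝒢 ⥤ BTemp P) (i : ObjectProperty.ι _ ⋙ restrictV 𝒢 v ≅ F ⋙ BTemp.res ψ)

/-- Pointwise naturality of (the inverse of) a natural isomorphism "restriction to `v` ≅ `F` ⋙
`B^temp(ψ)`". [cite: MochizukiSemiAnbd2006, Prop 3.6(ii) p.38] -/
theorem natIso_inv_app_map {T T' : BTempCat 𝒢} (f : T ⟶ T') (s : (F.obj T).obj.V) :
    (i.inv.app T').hom.hom ((F.map f).hom.hom s) = (f.hom.fV v).hom.hom ((i.inv.app T).hom.hom s) :=
  congrArg (fun φ => φ.hom.hom s) (i.inv.naturality f)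

/-- Pointwise equivariance of the components of `i.inv`: they intertwine the `P`-action through `ψ`
with the `Π_v`-action on `T_v`. [cite: MochizukiSemiAnbd2006, Prop 3.6(ii) p.38] -/
theorem natIso_inv_app_ρ (T : BTempCat 𝒢) (h : 𝒢.Gv v) (s : (F.obj T).obj.V) :
    (i.inv.app T).hom.hom ((F.obj T).obj.ρ (ψ h) s) = (T.obj.SV v).obj.ρ h ((i.inv.app T).hom.hom s) :=
  ConcreteCategory.congr_hom ((i.inv.app T).hom.comm h) s

end Generic

section NatIso

variable {v : 𝒢.graph.Vertex} {ψ : 𝒢.Gv v →ₜ* 𝒢.temperedPi h36}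
  (i : ObjectProperty.ι _ ⋙ restrictV 𝒢 v ≅ 𝒢.temperedFibreFunctor h36 ⋙ BTemp.res ψ)

/-- The `π₁^temp(𝒢)`-action on the fibre functor's value at `T` is `piAct` (definitional unfolding).
[cite: MochizukiSemiAnbd2006, Prop 3.6(ii) p.38] -/
theorem temperedFibreFunctor_obj_ρ_apply (T : BTempCat 𝒢) (γ : 𝒢.temperedPi h36)
    (s : (T.obj.SV (𝒢.baseVertex h36)).obj.V) :
    ((𝒢.temperedFibreFunctor h36).obj T).obj.ρ γ s =
      (𝒢.galoisLevelData h36).piAct h36.isCountable T.obj (𝒢.levelOf h36 T) (𝒢.levelOf_spec h36 T) γ s := by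
  simp only [temperedFibreFunctor, GaloisLevelData.fibreObj]
  rfl

/-- Pointwise naturality for the fibre functor: the components of `i.inv` commute with the fibre maps
`f_{v₀}` / `f_v` of every morphism of tempered coverings. [cite: MochizukiSemiAnbd2006, Prop 3.6(ii) p.38] -/
theorem natIso_inv_app_fV {T T' : BTempCat 𝒢} (f : T.obj ⟶ T'.obj)
    (s : (T.obj.SV (𝒢.baseVertex h36)).obj.V) :
    (i.inv.app T').hom.hom ((f.fV (𝒢.baseVertex h36)).hom.hom s) =
      (f.fV v).hom.hom ((i.inv.app T).hom.hom s) := by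
  exact natIso_inv_app_map (𝒢.temperedFibreFunctor h36) i (ObjectProperty.homMk f) s

/-- Pointwise equivariance for the fibre functor: the components of `i.inv` intertwine the
`π₁^temp`-action `piAct` through `ψ` on `T_{v₀}` with the `Π_v`-action on `T_v`.
[cite: MochizukiSemiAnbd2006, Prop 3.6(ii) p.38] -/
theorem natIso_inv_app_piAct (T : BTempCat 𝒢) (h : 𝒢.Gv v) (s : (T.obj.SV (𝒢.baseVertex h36)).obj.V) :
    (i.inv.app T).hom.hom ((𝒢.galoisLevelData h36).piAct h36.isCountable T.obj (𝒢.levelOf h36 T)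
      (𝒢.levelOf_spec h36 T) (ψ h) s) = (T.obj.SV v).obj.ρ h ((i.inv.app T).hom.hom s) := by
  rw [← temperedFibreFunctor_obj_ρ_apply]
  exact natIso_inv_app_ρ (𝒢.temperedFibreFunctor h36) i T h s

include i in
/-- A homomorphism `ψ` with "restriction to `v` ≅ fibre functor ⋙ `B^temp(ψ)`" is the decomposition
homomorphism of a compatible point sequence over `v` (evaluate the isomorphism on the tempered coverings
`𝒢_{∞,S n}`: natural `Π_v`-equivariant fibre maps; their values on the base points are the sequence).
[cite: MochizukiSemiAnbd2006, Thm 3.7(i) p.40] -/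
theorem exists_pointSeq_of_natIso :
    ∃ P : (𝒢.galoisLevelData h36).PointSeq h36.isCountable v, P.decompHom = ψ.toMonoidHom := by
  obtain ⟨P, -, hP⟩ := (𝒢.galoisLevelData h36).exists_pointSeq_decompHom_eq h36.isCountable
    ψ.toMonoidHom (fun n s => (i.inv.app (𝒢.coverT h36 n)).hom.hom s)
    (fun n s => natIso_inv_app_fV i (T := 𝒢.coverT h36 (n + 1)) (T' := 𝒢.coverT h36 n)
      ((𝒢.galoisLevelData h36).stepCover h36.isCountable n) s)
    (fun n σ s => natIso_inv_app_fV i (T := 𝒢.coverT h36 n) (T' := 𝒢.coverT h36 n) σ.hom s)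
    (𝒢.galoisLevelData_splits_component_bp h36)
    (fun n => 𝒢.levelOf h36 (𝒢.coverT h36 n)) (fun n => 𝒢.levelOf_spec h36 (𝒢.coverT h36 n))
    (fun n h s => natIso_inv_app_piAct i (𝒢.coverT h36 n) h s)
  exact ⟨P, hP⟩

end NatIso

/-- **Every verticial homomorphism `ψ : Π_v → π₁^temp(𝒢)` (for the constructed chart) is the
decomposition homomorphism of a compatible point sequence over `v`.**
[cite: MochizukiSemiAnbd2006, Thm 3.7(i) p.40] -/
theorem exists_pointSeq_of_isVerticialHom {v : 𝒢.graph.Vertex} {ψ : 𝒢.Gv v →ₜ* 𝒢.temperedPi h36}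
    (hψ : IsVerticialHom (𝒢.temperedPiChart h36) v ψ) :
    ∃ P : (𝒢.galoisLevelData h36).PointSeq h36.isCountable v, P.decompHom = ψ.toMonoidHom := by
  obtain ⟨i⟩ := (isVerticialHom_iff_nonempty_functorIso _ v _).1 hψ
  exact exists_pointSeq_of_natIso i

/-! ### (I1), (I2), (I3) for the constructed chart -/

/-- **(I1) for `π₁^temp(𝒢) = lim_n Aut(𝒢_{∞,S n})`: every verticial subgroup fixes a compatible system
of vertices of the trees `𝔾̃_n`** (it is the image of a decomposition homomorphism, whose image fixes
the vertex system of its point sequence). [cite: MochizukiSemiAnbd2006, Thm 3.7(iii) p.41] -/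
theorem fix_temperedPiChart (v : 𝒢.graph.Vertex) (H : Subgroup (𝒢.temperedPiChart h36).G)
    (hH : H ∈ verticialSubgroups (𝒢.temperedPiChart h36) v) :
    ∃ x : ∀ n, ((𝒢.galoisLevelData h36).tree n).Vertex,
      (∀ ⦃i j : ℕ⦄ (h : i ≤ j), ((𝒢.galoisLevelData h36).treeTrans h).vertexMap (x j) = x i) ∧
      ∀ g ∈ H, ∀ n, ((𝒢.galoisLevelData h36).treeAct h36.isCountable n
        (MonoidHom.id (𝒢.temperedPiChart h36).G g)).hom.vertexMap (x n) = x n := by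
  obtain ⟨ψ, hψ, rfl⟩ := hH
  obtain ⟨P, hP⟩ := exists_pointSeq_of_isVerticialHom (h36 := h36) (v := v) (ψ := ψ) hψ
  refine ⟨P.vertex, fun i j h => P.treeTrans_vertex h, ?_⟩
  rintro g ⟨h, rfl⟩ n
  change ((𝒢.galoisLevelData h36).treeAct h36.isCountable n (ψ.toMonoidHom h)).hom.vertexMap
    (P.vertex n) = P.vertex n
  rw [← hP]
  exact P.treeAct_decompHom_vertexMap n h

/-- **(I2) for `π₁^temp(𝒢)`: the pointwise stabiliser of a compatible system of tree vertices lies in a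
verticial subgroup** (the image of the decomposition homomorphism of a point sequence over the system,
verticial by `isVerticialHom_decompHomCont`). [cite: MochizukiSemiAnbd2006, Thm 3.7(iii) p.41] -/
theorem stab_temperedPiChart (x : ∀ n, ((𝒢.galoisLevelData h36).tree n).Vertex)
    (hx : ∀ ⦃i j : ℕ⦄ (h : i ≤ j), ((𝒢.galoisLevelData h36).treeTrans h).vertexMap (x j) = x i) :
    ∃ (v : 𝒢.graph.Vertex) (H : Subgroup (𝒢.temperedPiChart h36).G),
      H ∈ verticialSubgroups (𝒢.temperedPiChart h36) v ∧
      ∀ g : (𝒢.temperedPiChart h36).G, (∀ n, ((𝒢.galoisLevelData h36).treeAct h36.isCountable n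
        (MonoidHom.id (𝒢.temperedPiChart h36).G g)).hom.vertexMap (x n) = x n) → g ∈ H := by
  obtain ⟨v, P, -, hstab⟩ :=
    (𝒢.galoisLevelData h36).exists_decompHom_range_of_fixes h36.isCountable x hx
  exact ⟨v, (P.decompHom).range, P.range_decompHom_mem_verticialSubgroups, fun g hg => hstab g hg⟩

/-- **(I3) for `π₁^temp(𝒢)`: the stabiliser of an eventual compatible system of tree edges lies in an
edge-like subgroup of the common image edge** (the image of the edge decomposition homomorphism of an
edge-point sequence over the system; branch-fixing is not needed). [cite: MochizukiSemiAnbd2006, Thm 3.7(iii) p.41] -/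
theorem edge_temperedPiChart (j₁ : ℕ)
    (ε : ∀ j : {j : ℕ // j₁ ≤ j}, ((𝒢.galoisLevelData h36).tree j.1).Edge)
    (hε : ∀ ⦃i j : {j : ℕ // j₁ ≤ j}⦄ (h : i.1 ≤ j.1),
      ((𝒢.galoisLevelData h36).treeTrans h).edgeMap (ε j) = ε i) :
    ∃ (e : 𝒢.graph.Edge) (L : Subgroup (𝒢.temperedPiChart h36).G),
      L ∈ edgeLikeSubgroups (𝒢.temperedPiChart h36) e ∧
      (∀ j, ((𝒢.galoisLevelData h36).treeProj j.1).edgeMap (ε j) = e) ∧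
      ∀ g : (𝒢.temperedPiChart h36).G,
        (∀ j, ((𝒢.galoisLevelData h36).treeAct h36.isCountable j.1
            (MonoidHom.id (𝒢.temperedPiChart h36).G g)).hom.edgeMap (ε j) = ε j ∧
          ∀ b : ((𝒢.galoisLevelData h36).tree j.1).Branch, ((𝒢.galoisLevelData h36).tree j.1).edgeOf b = ε j →
            ((𝒢.galoisLevelData h36).treeAct h36.isCountable j.1
              (MonoidHom.id (𝒢.temperedPiChart h36).G g)).hom.branchMap b = b) → g ∈ L := by
  obtain ⟨e, Q, -, hproj, hstab⟩ := GaloisLevelData.exists_decompHomE_range_of_fixes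
    (D := 𝒢.galoisLevelData h36) h36.isCountable j₁ ε hε h36.isConnected
  exact ⟨e, (Q.decompHomE h36.isConnected).range, Q.range_decompHomE_mem_edgeLikeSubgroups, hproj,
    fun g hg => hstab g fun j => (hg j).1⟩

/-- **The level data of Thm. 3.7 (iii) for the constructed chart** (rung-1 producer contract of
`TemperedLevelData.lean`): the trees `𝔾̃_n` of the Galois tower of Prop. 3.6 with the action of
`π₁^temp(𝒢) = lim_n Aut(𝒢_{∞,S n})` and the identifications (I1)–(I3).
[cite: MochizukiSemiAnbd2006, Thm 3.7(iii) p.41] -/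
noncomputable def verticialLevelData_temperedPiChart :
    VerticialLevelData.{0} 𝒢 (𝒢.temperedPiChart h36) :=
  (𝒢.galoisLevelData h36).verticialLevelDataOfTower h36.isCountable (𝒢.temperedPiChart h36)
    (MonoidHom.id _) continuous_id (fix_temperedPiChart (h36 := h36))
    (stab_temperedPiChart (h36 := h36)) (edge_temperedPiChart (h36 := h36))

/-- The level data is nonempty (existence form). [cite: MochizukiSemiAnbd2006, Thm 3.7(iii) p.41] -/
theorem nonempty_verticialLevelData_temperedPiChart :
    Nonempty (VerticialLevelData.{0} 𝒢 (𝒢.temperedPiChart h36)) :=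
  ⟨verticialLevelData_temperedPiChart⟩

end ProfiniteSemiGraph

end Literature.AnabelianGeometry.SemiGraphs
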